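import Summits.KontsevichZagierPeriods.KontsevichZagierPeriods.Theorems.LinRedNormalFormArrangementNormalFormSeparateHighFanLemma
import Summits.KontsevichZagierPeriods.KontsevichZagierPeriods.Theorems.LinRedNormalFormArrangementNormalFormSeparateHighFan

/-!
# `stub_separateHigh`, unconditionally up to the intermediate class `GG♮`

(Line `janus-bands`, crux `ArrangementNormalForm`, stubs `stub_separateHigh` /
`stub_separateThreeZero` — separation in base dimension `≥ 3`; part `Natural` (registered as
`separateHigh_natural`), valid in every base dimension `B + 2 ≥ 2`.)

**Theorem** (`separateHigh_natural`). Every Janus band representation `s` over the base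
`ℝ^{B+2}` with `k` fibres (literal `JJ (B+2) k` data: letters `L, e`, numerator `p`, fibre data
`a, lo, hi`, on a bounded rational cell) is congruent modulo `KZ.relations` to a `ℤ`-combination
of elements of the literal intermediate class `GG♮ (B+1) k` (= `SeparatePos.GNset (B+1) k`:
separated Janus band representations over the base `ℝ^{(B+1)+1}` with a SINGLE pole
`(ỹ − ℓ(x̃'))^{−n}` in the distinguished last coordinate, non-vanishing on the domain, letters in
the first `B + 1` coordinates only, and an ARBITRARY polynomial numerator in all `B + 2` base
coordinates). No hypothesis on the numerator, no hypothesis on the flats of the letters.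

Proof: the landed fan lemma `separateHigh_fan` produces the fan certificate of `[s]`, and the
landed `separateHigh_of_fan_carry` turns a fan certificate into the intermediate class (rational
base change along the direction of each piece, then the separation engine carrying the
numerator). What separates this from the registered stub `stub_separateHigh`
(`→ closure (GG (B+1) 1 k)`) is exactly the numerator split `GG♮ → GG` for numerators whose
zeros on the closed cell buy the convergence; the cases where it is free are
`separateHigh_fanPos` (numerator bounded away from zero) and `separateHigh_fanFree`
(numerator-free integrand integrable).
-/

noncomputable section

open Set MeasureTheory MvPolynomial

namespace Summit.KontsevichZagierPeriods.ArrangementNormalForm.JanusBands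

open Literature.NumberTheory.Transcendental

open SeparatePos SepHigh in
/-- **`JJ (B+2) k → closure GG♮ (B+1) k`, unconditionally** (registered part
`separateHigh_natural` of `stub_separateHigh`; every base dimension `B + 2 ≥ 2`): every Janus
band representation over `ℝ^{B+2}` with `k` fibres is congruent modulo `KZ.relations` to a
`ℤ`-combination of elements of the literal intermediate class `GG♮ (B+1) k` (one non-vanishing
pole in the distinguished coordinate, arbitrary numerator); see the module docstring.
[Kontsevich–Zagier 2001, §1.2] -/
theorem separateHigh_natural (B k m m' : ℕ) (s : KZ.IntegralRep (B + 2 + k)) (M : Fin m' → (Fin (B + 2) → ℚ) × ℚ) (L : Fin m → (Fin (B + 2) → ℚ) × ℚ) (e : Fin m → ℕ) (p : MvPolynomial (Fin (B + 2)) ℚ) (a : Fin k → Option ((Fin (B + 2) → ℚ) × ℚ)) (lo hi : Fin k → Fin k ⊕ ((Fin (B + 2) → ℚ) × ℚ)) (hbd : Bornology.IsBounded s.domain) (hdom : s.domain = {z | (∀ j, 0 < ∑ i, ((M j).1 i : ℝ) * z (Fin.castAdd k i) + ((M j).2 : ℝ)) ∧ ∀ i, Sum.elim (fun j => z (Fin.natAdd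 (B + 2) j)) (fun c => ∑ i', (c.1 i' : ℝ) * z (Fin.castAdd k i') + (c.2 : ℝ)) (lo i) < z (Fin.natAdd (B + 2) i) ∧ z (Fin.natAdd (B + 2) i) < Sum.elim (fun j => z (Fin.natAdd (B + 2) j)) (fun c => ∑ i', (c.1 i' : ℝ) * z (Fin.castAdd k i') + (c.2 : ℝ)) (hi i)}) (hint : EqOn s.integrand (fun z => MvPolynomial.aeval (fun i => z (Fin.castAdd k i)) p / (∏ j, (∑ i, ((L j).1 i : ℝ) * z (Fin.castAdd k i) + ((L j).2 : ℝ)) ^ e j) * ∏ i, (a i).elim 1 (fun c => 1 / (z (Fin.natAdd (B + 2) i) - (∑ i', (c.1 i' : ℝ) * z (Fin.castAdd k i') + (c.2 : ℝ))))) s.domain) : ∃ c ∈ AddSubgroup.closure {w : KZ.FormalRep | ∃ (m m' n : ℕ) (s : KZ.IntegralRep (B + 1 + 1 + k)) (M : Fin m' → (Fin (B + 1 + 1) → ℚ) × ℚ) (L : Fin m → (Fin (B + 1) → ℚ) × ℚ) (e : Fin m → ℕ) (p : MvPolynomial (Fin (B + 1 + 1)) ℚ) (ℓ : (Fin (B +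 1) → ℚ) × ℚ) (a : Fin k → Option ((Fin (B + 1 + 1) → ℚ) × ℚ)) (lo hi : Fin k → Fin k ⊕ ((Fin (B + 1 + 1) → ℚ) × ℚ)), (n ≠ 0 → ∀ z ∈ s.domain, z (Fin.castAdd k (Fin.last (B + 1))) - (∑ i, (ℓ.1 i : ℝ) * z (Fin.castAdd k (Fin.castSucc i)) + (ℓ.2 : ℝ)) ≠ 0) ∧ Bornology.IsBounded s.domain ∧ s.domain = {z | (∀ j, 0 < ∑ i, ((M j).1 i : ℝ) * z (Fin.castAdd k i) + ((M j).2 : ℝ)) ∧ ∀ i, Sum.elim (fun j => z (Fin.natAdd (B + 1 + 1) j)) (fun c => ∑ i', (c.1 i' : ℝ) * z (Fin.castAdd k i') + (c.2 : ℝ)) (lo i) < z (Fin.natAdd (B + 1 + 1) i) ∧ z (Fin.natAdd (B + 1 + 1) i) < Sum.elim (fun j => z (Fin.natAdd (B + 1 + 1) j)) (fun c => ∑ i', (c.1 i' : ℝ) * z (Fin.castAdd k i') + (c.2 : ℝ)) (hi i)} ∧ EqOn s.integrand (fun z => MvPolynomial.aeval (fun i => z (Fin.castAdd k i)) p / (∏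 j, (∑ i, ((L j).1 i : ℝ) * z (Fin.castAdd k (Fin.castSucc i)) + ((L j).2 : ℝ)) ^ e j) * (1 / (z (Fin.castAdd k (Fin.last (B + 1))) - (∑ i, (ℓ.1 i : ℝ) * z (Fin.castAdd k (Fin.castSucc i)) + (ℓ.2 : ℝ))) ^ n) * ∏ i, (a i).elim 1 (fun c => 1 / (z (Fin.natAdd (B + 1 + 1) i) - (∑ i', (c.1 i' : ℝ) * z (Fin.castAdd k i') + (c.2 : ℝ))))) s.domain ∧ w = KZ.of s}, KZ.of s - c ∈ KZ.relations :=
  separateHigh_of_fan_carry B k m L e p a lo hi (KZ.of s)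
    (separateHigh_fan B k m m' s M L e p a lo hi hbd hdom hint)

open SeparatePos SepHigh in
/-- The same, with the target written as `SeparatePos.GNset (B + 1) k`. [Kontsevich–Zagier 2001,
§1.2] -/
theorem separateHigh_natural_GNset (B k m m' : ℕ) (s : KZ.IntegralRep (B + 2 + k)) (M : Fin m' → (Fin (B + 2) → ℚ) × ℚ) (L : Fin m → (Fin (B + 2) → ℚ) × ℚ) (e : Fin m → ℕ) (p : MvPolynomial (Fin (B + 2)) ℚ) (a : Fin k → Option ((Fin (B + 2) → ℚ) × ℚ)) (lo hi : Fin k → Fin k ⊕ ((Fin (B + 2) → ℚ) × ℚ)) (hbd : Bornology.IsBounded s.domain) (hdom : s.domain = {z | (∀ j, 0 < ∑ i, ((M j).1 i : ℝ) * z (Fin.castAdd k i) + ((M j).2 : ℝ)) ∧ ∀ i, Sum.elim (fun j => z (Fin.natAdd (B + 2) j)) (fun c => ∑ i', (c.1 i' : ℝ) * z (Fin.castAdd k i') + (c.2 : ℝ)) (lo i) < z (Fin.natAdd (B + 2) i) ∧ z (Fin.natAdd (B + 2) i) < Sum.elim (fun j => z (Fin.natAdd (B + 2) j)) (fun c =>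 ∑ i', (c.1 i' : ℝ) * z (Fin.castAdd k i') + (c.2 : ℝ)) (hi i)}) (hint : EqOn s.integrand (fun z => MvPolynomial.aeval (fun i => z (Fin.castAdd k i)) p / (∏ j, (∑ i, ((L j).1 i : ℝ) * z (Fin.castAdd k i) + ((L j).2 : ℝ)) ^ e j) * ∏ i, (a i).elim 1 (fun c => 1 / (z (Fin.natAdd (B + 2) i) - (∑ i', (c.1 i' : ℝ) * z (Fin.castAdd k i') + (c.2 : ℝ))))) s.domain) : ∃ c ∈ AddSubgroup.closure (SeparatePos.GNset (B + 1) k), KZ.of s - c ∈ KZ.relations :=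
  separateHigh_natural B k m m' s M L e p a lo hi hbd hdom hint

end Summit.KontsevichZagierPeriods.ArrangementNormalForm.JanusBands
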